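/-
Copyright (c) 2026. All rights reserved.
Released under Apache 2.0 license as described in the file LICENSE.
-/
import Literature.NumberTheory.ComplexMultiplication.DegenerateCMTypesAbelianStabilizerIndexBound
import HarnessLib

/-!
# The characters trivial on the stabiliser of a CM type are the group generated by Kubota's survivors

SETTING (tree `CMTypeRankCharacters`, `DegenerateCMTypesAbelianStabilizerCharacters`,
`DegenerateCMTypesAbelianStabilizerIndexBound`; T. Kubota [Kubota1965] §4 Lemma 2 = B. B. Gordon
[Gordon1999HodgeAVSurvey] Prop. 9.4.1).  `G` a finite commutative group — the Galois group of an ABELIAN CM field `K`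
— `ρ ∈ G` (complex conjugation), `T ⊆ G` a CM type (`IsCMTypeWith ρ T`), `Ŝ(χ) = Σ_{t ∈ T} χ(t)` for a character
`χ : AddChar (Additive G) ℂ` (an additive group under Mathlib's conventions: `(χ + ψ)(g) = χ(g)ψ(g)`), the SURVIVORS
`S(T) = {χ : χ(ρ) = −1, Ŝ(χ) ≠ 0}` (so `rank(T) = 1 + #S(T)`, Kubota), and the stabiliser `Stab(T) = {g : Tg = T}` —
on the field side `Gal(K/K*)`, `K*` the reflex field ([Dodson1984] §1.3: "`K'(Φ)` is the subfield of `K^c` fixed by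
the stabilizer of `Φ`", `[K' : ℚ] = (G : H'(Φ))`; [Shimura1998] §8.4 Example (1)).  The tree knows
`Stab(T) = ⋂_{χ ∈ S(T)} ker χ` (`AbelianStabilizer.forall_mul_mem_iff_iff_forall_survivor`) and
`2·|Stab(T)|·(rank(T) − 1) ≤ |G|` with equality iff every odd character trivial on `Stab(T)` survives
(`two_mul_card_stabilizer_mul_eq_iff`).  THIS FILE passes to the DUAL SIDE by Pontryagin duality for finite abelian
groups (the pairing `G × Ĝ → ℂˣ` is perfect: [Brzezinski2018] Thm. A.12.1, Lemma A.12.2):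

> **Theorem** (`forall_stabilizer_apply_eq_one_iff_mem_closure`).  A character `χ` of `G` is trivial on `Stab(T)`
> **iff `χ` lies in the subgroup `⟨S(T)⟩ ≤ Ĝ` generated by the survivors.**  Hence (`card_filter_mem_closure_mul_card_stabilizer_eq`)
> `|⟨S(T)⟩|·|Stab(T)| = |G|` — on the field side `⟨S(T)⟩` IS THE CHARACTER GROUP OF `Gal(K*/ℚ)` and
> `[K* : ℚ] = |⟨S(T)⟩|` — and (`two_mul_typeRank_sub_one_le_card_filter_mem_closure`) `2·(rank(T) − 1) ≤ |⟨S(T)⟩|`,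
> **with equality iff every odd character of `⟨S(T)⟩` is a survivor** (`two_mul_card_stabilizer_mul_eq_iff_forall_mem_closure`,
> `two_mul_card_stabilizer_mul_eq_iff_two_mul_typeRank_sub_one_eq`): the equality case of the stabiliser bound —
> on the field side `Bᵐ(A) ⊗ ℂ = Dᵐ(A) ⊗ ℂ` for all `m` (tree `Pohlmann1968.forall_hodgeClassSpan_eq_iff_forall_oddCharacter`)
> — is read off the survivors ALONE, with no reference to the elements of `G`.

So an odd sum of an odd number of survivors that is annihilated by `T` (`two_mul_card_stabilizer_mul_lt_of_sum_vanishing`;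
three survivors `χ₁, χ₂, χ₃` with `Ŝ(χ₁ + χ₂ + χ₃) = 0`, `two_mul_card_stabilizer_mul_lt_of_add_add_vanishing`) forces
the strict inequality — an exceptional Hodge class on the abelian variety itself, on the field side — while the
majority types of the tree (`S = {χ₁, χ₂, χ₃, χ₁+χ₂+χ₃}`, closed) sit in the equality case; and `T` is PRIMITIVE
(`Stab(T) = 1`) iff the survivors generate ALL of `Ĝ` (`forall_stabilizer_eq_one_iff_closure_eq_top`).

* §1 PONTRYAGIN DUALITY FOR A GROUP OF CHARACTERS `H ≤ Ĝ` (every finite commutative `G`): `sum_filter_mem_apply_eq`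
  (`Σ_{χ ∈ H} χ(g) = |H|·[g ∈ H^⊥]`), **`card_filter_mem_mul_card_annihilator_eq`** (`|H|·|H^⊥| = |G|`),
  `sum_annihilator_apply_eq`, `card_annihilator_mul_card_filter_eq` (`|H^⊥|·|H^⊥⊥| = |G|`),
  **`forall_annihilator_apply_eq_one_iff_mem`** (`H^⊥⊥ = H`: a character trivial on `⋂_{ψ ∈ H} ker ψ` lies in `H`).
* §2 THE SURVIVORS GENERATE THE DUAL OF `G/Stab(T)`: `forall_mem_closure_apply_eq_one_iff` (`⟨S⟩^⊥ = Stab(T)`),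
  **`forall_stabilizer_apply_eq_one_iff_mem_closure`** (`Stab(T)^⊥ = ⟨S⟩`), `filter_mem_closure_eq`,
  **`card_filter_mem_closure_mul_card_stabilizer_eq`** / `natCard_closure_mul_card_stabilizer_eq` (`|⟨S⟩|·|Stab| = |G|`),
  `card_filter_mem_closure_dvd`, `two_mul_card_filter_odd_mem_closure_eq` (half of `⟨S⟩` is odd),
  **`forall_stabilizer_eq_one_iff_closure_eq_top`** (primitive iff `⟨S⟩ = Ĝ`).
* §3 THE RANK: `two_mul_typeRank_sub_one_le_card_filter_mem_closure` (`2(rank − 1) ≤ |⟨S⟩|`),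
  **`two_mul_card_stabilizer_mul_eq_iff_forall_mem_closure`**, **`two_mul_card_stabilizer_mul_eq_iff_two_mul_typeRank_sub_one_eq`**
  (`= ⟺ 2(rank − 1) = |⟨S⟩|`), `two_mul_card_stabilizer_mul_lt_iff_exists_mem_closure` (`< ⟺` an odd character of
  `⟨S⟩` is annihilated by `T`), `two_mul_card_stabilizer_mul_lt_of_sum_vanishing`,
  `two_mul_card_stabilizer_mul_lt_of_add_add_vanishing`.

HONEST SCOPE.  Finite Fourier analysis (orthogonality `AddChar.sum_apply_eq_ite`, `AddChar.sum_eq_zero_iff_ne_zero`)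
and counting; the sources print Kubota's formula (Kubota, Gordon), the stabiliser–reflex-field dictionary and the
reflex degree `[K* : ℚ] = [G : Stab]` (Dodson, Shimura) and the duality of finite abelian groups (Brzeziński); the
survivor-closure form of the stabiliser, of the reflex degree and of the equality criterion is this file's packaging,
not a numbered statement of the sources.  THEOREMS ONLY: no definition, no named fact, no instance, no `sorry`.

## References

* [Kubota1965] T. Kubota, *On the field extension by complex multiplication*, Trans. AMS 118 (1965), §2 (p. 115),
  §4 Lemma 2 (p. 119).
* [Gordon1999HodgeAVSurvey] B. B. Gordon, *A survey of the Hodge conjecture for abelian varieties*, Prop. 9.4.1.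
* [Dodson1984] B. Dodson, *The structure of Galois groups of CM-fields*, Trans. AMS 283 (1984), §1.3 Reflex Degree
  Theorem (proof and Remark), §3.1.1.
* [Shimura1998] G. Shimura, *Abelian Varieties with Complex Multiplication and Modular Functions*, §8.4 Example (1),
  §32.10.
* [Brzezinski2018] J. Brzeziński, *Galois Theory Through Exercises*, Springer (2018), Appendix: Characters and
  Pairing, Thm. A.12.1 (`|Ĝ| = |G|`), Lemma A.12.2 (kernels of a pairing).

## Provenance

Lane `lit-hodgefound` (Track 2, Layer A3), seat `lit-hodgefound-p10` generation 40, row g40-#1; neighbours cited by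
name, nothing restated: `DegenerateCMTypesAbelianStabilizerCharacters` (`forall_mul_mem_iff_of_forall_survivor`,
`survivor_apply_eq_one_of_forall_mul_mem_iff`, `sum_char_image_mul_eq`), `DegenerateCMTypesAbelianStabilizerIndexBound`
(`two_mul_card_stabilizer_mul_eq_iff`, `two_mul_card_stabilizer_mul_typeRank_sub_one_le`, `two_mul_card_filter_odd_eq`,
`card_stabilizer_pos`, `one_mem_stabilizer`, `forall_mul_mul_mem_iff`), `CMTypeRankCharacters`
(`IsCMTypeWith.typeRank_eq_one_add_ncard_oddCharacters`), Mathlib `AddChar.sum_apply_eq_ite`,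
`AddChar.sum_eq_zero_iff_ne_zero`, `AddChar.forall_apply_eq_zero`, `AddSubgroup.closure_induction`.
-/

open scoped BigOperators Classical

namespace Literature.NumberTheory.ComplexMultiplication

namespace CyclicCMType

namespace AbelianStabilizer

variable {G : Type*} [CommGroup G] [Fintype G] [DecidableEq G] {ρ : G} {T : Finset G}

/-! ## §0 Helpers -/

section Helpers

omit [Fintype G] [DecidableEq G] in
/-- `χ(gh) = χ(g)χ(h)`. [folklore] -/
private theorem char_mul_sc (χ : AddChar (Additive G) ℂ) (g h : G) :
    χ (Additive.ofMul (g * h)) = χ (Additive.ofMul g) * χ (Additive.ofMul h) := by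
  rw [ofMul_mul, AddChar.map_add_eq_mul]

omit [Fintype G] [DecidableEq G] in
/-- `χ(1) = 1`. [folklore] -/
private theorem char_one_sc (χ : AddChar (Additive G) ℂ) : χ (Additive.ofMul (1 : G)) = 1 := by
  rw [ofMul_one, AddChar.map_zero_eq_one]

/-- Dual orthogonality: `Σ_χ χ(x) = |G|·[x = 1]` (Mathlib `AddChar.sum_apply_eq_ite`). [folklore] -/
private theorem sum_char_apply_eq_ite_sc (x : G) :
    ∑ χ : AddChar (Additive G) ℂ, χ (Additive.ofMul x) = if x = 1 then (Fintype.card G : ℂ) else 0 := by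
  have h := AddChar.sum_apply_eq_ite (α := Additive G) (Additive.ofMul x)
  have hc : Fintype.card (Additive G) = Fintype.card G := Fintype.card_congr Additive.toMul
  rw [h, hc]
  rfl

omit [DecidableEq G] in
/-- Orthogonality: a non-trivial character sums to `0` over `G` (Mathlib `AddChar.sum_eq_zero_iff_ne_zero`). [folklore] -/
private theorem sum_univ_apply_eq_zero_sc {χ : AddChar (Additive G) ℂ} (hχ : χ ≠ 0) :
    ∑ g : G, χ (Additive.ofMul g) = 0 := by
  have h : ∑ a : Additive G, χ a = 0 := AddChar.sum_eq_zero_iff_ne_zero.2 hχ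
  rw [← h]
  exact Fintype.sum_equiv Additive.ofMul _ _ fun _ => rfl

/-- If every `χ(s)`, `s ∈ B`, is `1` or some is not: `Σ_{s ∈ B} χ(s) = |B|·[χ|_B = 1]` for a finset `B` closed under
multiplication (a value `χ(s₀) ≠ 1`, `s₀ ∈ B`, gives `Σ = χ(s₀)Σ` since `B·s₀ = B`). [folklore] -/
private theorem sum_char_eq_ite_of_mul_mem_sc {B : Finset G} (hmul : ∀ x ∈ B, ∀ y ∈ B, x * y ∈ B)
    (χ : AddChar (Additive G) ℂ) :
    ∑ s ∈ B, χ (Additive.ofMul s) = if ∀ s ∈ B, χ (Additive.ofMul s) = 1 then (B.card : ℂ) else 0 := by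
  split_ifs with htriv
  · rw [Finset.sum_congr rfl fun s hs => htriv s hs, Finset.sum_const, nsmul_eq_mul, mul_one]
  · push Not at htriv
    obtain ⟨s₀, hs₀, hne⟩ := htriv
    have himage : B.image (fun s => s * s₀) = B := by
      apply Finset.eq_of_subset_of_card_le
      · intro x hx
        rw [Finset.mem_image] at hx
        obtain ⟨s, hs, rfl⟩ := hx
        exact hmul s hs s₀ hs₀
      · rw [Finset.card_image_of_injective _ (mul_left_injective s₀)]
    have h1 := sum_char_image_mul_eq χ B s₀
    rw [himage] at h1
    have h2 : (χ (Additive.ofMul s₀) - 1) * ∑ s ∈ B, χ (Additive.ofMul s) = 0 := by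
      rw [sub_mul, one_mul, ← h1, sub_self]
    rcases mul_eq_zero.1 h2 with h3 | h3
    · exact absurd (sub_eq_zero.1 h3) hne
    · exact h3

/-- `|B|·#{χ : χ|_B = 1} = |G|` for a finset `B ∋ 1` on which every character sums to `|B|·[χ|_B = 1]` (sum
`Σ_χ Σ_{s ∈ B} χ(s)` in both orders). [folklore] -/
private theorem card_mul_card_filter_eq_sc {B : Finset G} (h1 : (1 : G) ∈ B)
    (hsum : ∀ χ : AddChar (Additive G) ℂ, ∑ s ∈ B, χ (Additive.ofMul s) =
      if ∀ s ∈ B, χ (Additive.ofMul s) = 1 then (B.card : ℂ) else 0) :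
    B.card * (Finset.univ.filter fun χ : AddChar (Additive G) ℂ => ∀ s ∈ B, χ (Additive.ofMul s) = 1).card =
      Fintype.card G := by
  have hA : ∑ χ : AddChar (Additive G) ℂ, ∑ s ∈ B, χ (Additive.ofMul s) = Fintype.card G := by
    rw [Finset.sum_comm, Finset.sum_congr rfl fun s _ => sum_char_apply_eq_ite_sc s, Finset.sum_ite_eq' B (1 : G),
      if_pos h1]
  have hB : ∑ χ : AddChar (Additive G) ℂ, ∑ s ∈ B, χ (Additive.ofMul s) =
      (B.card : ℂ) * ((Finset.univ.filter fun χ : AddChar (Additive G) ℂ =>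
        ∀ s ∈ B, χ (Additive.ofMul s) = 1).card : ℂ) := by
    rw [Finset.sum_congr rfl fun χ _ => hsum χ, ← Finset.sum_filter, Finset.sum_const, nsmul_eq_mul, mul_comm]
  have := hA.symm.trans hB
  exact_mod_cast this.symm

omit [Fintype G] [DecidableEq G] in
/-- `ρ² = 1`. [folklore] -/
private theorem rho_mul_rho_sc (h : IsCMTypeWith ρ (T : Set G)) : ρ * ρ = 1 := by
  have := h.invol (1 : G)
  simpa [smul_eq_mul] using this

omit [Fintype G] [DecidableEq G] in
/-- `χ(ρ) = ±1`. [folklore] -/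
private theorem char_rho_sc (h : IsCMTypeWith ρ (T : Set G)) (χ : AddChar (Additive G) ℂ) :
    χ (Additive.ofMul ρ) = 1 ∨ χ (Additive.ofMul ρ) = -1 :=
  character_apply_eq_one_or_of_mul_self χ (rho_mul_rho_sc h)

omit [DecidableEq G] in
/-- Kubota's count with the survivors as a finset: `rank = 1 + #surv`. [cite: Kubota1965, §4 Lemma 2] -/
private theorem typeRank_eq_one_add_card_sc (h : IsCMTypeWith ρ (T : Set G)) :
    typeRank G (T : Set G) = 1 + ((Finset.univ.filter fun χ : AddChar (Additive G) ℂ =>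
      χ (Additive.ofMul ρ) = -1).filter fun χ => ∑ s ∈ T, χ (Additive.ofMul s) ≠ 0).card := by
  rw [h.typeRank_eq_one_add_ncard_oddCharacters, ← Set.ncard_coe_finset]
  congr 2
  ext χ
  simp only [Set.mem_setOf_eq, Finset.coe_filter, Finset.mem_filter, Finset.mem_univ, true_and]

end Helpers

/-! ## §1 Pontryagin duality for a group of characters `H ≤ Ĝ` on a finite commutative group -/

section Duality

omit [DecidableEq G] in
/-- **`Σ_{χ ∈ H} χ(g) = |H|` if every `χ ∈ H` has `χ(g) = 1`, `= 0` otherwise** (a `χ₀ ∈ H` with `χ₀(g) ≠ 1` gives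
`Σ = χ₀(g)·Σ`, since `H + χ₀ = H`), for a subgroup `H` of the character group of a finite commutative group.
[cite: Brzezinski2018, Appendix Thm. A.12.1 and Lemma A.12.2] -/
theorem sum_filter_mem_apply_eq (H : AddSubgroup (AddChar (Additive G) ℂ)) (g : G) :
    ∑ χ ∈ Finset.univ.filter (fun χ : AddChar (Additive G) ℂ => χ ∈ H), χ (Additive.ofMul g) =
      if ∀ χ ∈ H, χ (Additive.ofMul g) = 1 then
        ((Finset.univ.filter fun χ : AddChar (Additive G) ℂ => χ ∈ H).card : ℂ) else 0 := by
  split_ifs with htriv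
  · rw [Finset.sum_congr rfl fun χ hχ => htriv χ (Finset.mem_filter.1 hχ).2, Finset.sum_const, nsmul_eq_mul,
      mul_one]
  · push Not at htriv
    obtain ⟨χ₀, hχ₀, hne⟩ := htriv
    have himage : (Finset.univ.filter fun χ : AddChar (Additive G) ℂ => χ ∈ H).image (fun χ => χ + χ₀) =
        Finset.univ.filter fun χ : AddChar (Additive G) ℂ => χ ∈ H := by
      apply Finset.eq_of_subset_of_card_le
      · intro ψ hψ
        rw [Finset.mem_image] at hψ
        obtain ⟨χ, hχ, rfl⟩ := hψ
        simp only [Finset.mem_filter, Finset.mem_univ, true_and] at hχ ⊢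
        exact H.add_mem hχ hχ₀
      · rw [Finset.card_image_of_injective _ (add_left_injective χ₀)]
    have h1 : ∑ χ ∈ Finset.univ.filter (fun χ : AddChar (Additive G) ℂ => χ ∈ H), χ (Additive.ofMul g) =
        χ₀ (Additive.ofMul g) *
          ∑ χ ∈ Finset.univ.filter (fun χ : AddChar (Additive G) ℂ => χ ∈ H), χ (Additive.ofMul g) := by
      conv_lhs => rw [← himage]
      rw [Finset.sum_image fun a _ b _ hab => add_right_cancel hab, Finset.mul_sum]
      exact Finset.sum_congr rfl fun χ _ => by rw [AddChar.add_apply, mul_comm]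
    have h2 : (χ₀ (Additive.ofMul g) - 1) *
        ∑ χ ∈ Finset.univ.filter (fun χ : AddChar (Additive G) ℂ => χ ∈ H), χ (Additive.ofMul g) = 0 := by
      rw [sub_mul, one_mul, ← h1, sub_self]
    rcases mul_eq_zero.1 h2 with h3 | h3
    · exact absurd (sub_eq_zero.1 h3) hne
    · exact h3

omit [DecidableEq G] in
/-- **`|H|·|H^⊥| = |G|`** for a subgroup `H ≤ Ĝ` of the characters of a finite commutative group `G` and its annihilator
`H^⊥ = {g : χ(g) = 1 ∀ χ ∈ H} = ⋂_{χ ∈ H} ker χ` (sum `Σ_{χ ∈ H} Σ_{g ∈ G} χ(g)` in both orders: only `χ = 1`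
survives the inner sum over `G`).  `H` is the character group of `G/H^⊥`. [cite: Brzezinski2018, Appendix Thm. A.12.1 and Lemma A.12.2] -/
theorem card_filter_mem_mul_card_annihilator_eq (H : AddSubgroup (AddChar (Additive G) ℂ)) :
    (Finset.univ.filter fun χ : AddChar (Additive G) ℂ => χ ∈ H).card *
      (Finset.univ.filter fun g : G => ∀ χ ∈ H, χ (Additive.ofMul g) = 1).card = Fintype.card G := by
  have h0 : (0 : AddChar (Additive G) ℂ) ∈ Finset.univ.filter (fun χ : AddChar (Additive G) ℂ => χ ∈ H) :=
    Finset.mem_filter.2 ⟨Finset.mem_univ _, H.zero_mem⟩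
  have hA : ∑ χ ∈ Finset.univ.filter (fun χ : AddChar (Additive G) ℂ => χ ∈ H),
      ∑ g : G, χ (Additive.ofMul g) = Fintype.card G := by
    rw [Finset.sum_eq_single_of_mem (0 : AddChar (Additive G) ℂ) h0 fun χ _ hne => sum_univ_apply_eq_zero_sc hne]
    simp only [AddChar.zero_apply, Finset.sum_const, Finset.card_univ, nsmul_eq_mul, mul_one]
  have hB : ∑ χ ∈ Finset.univ.filter (fun χ : AddChar (Additive G) ℂ => χ ∈ H),
      ∑ g : G, χ (Additive.ofMul g) =
      ((Finset.univ.filter fun χ : AddChar (Additive G) ℂ => χ ∈ H).card : ℂ) *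
        ((Finset.univ.filter fun g : G => ∀ χ ∈ H, χ (Additive.ofMul g) = 1).card : ℂ) := by
    rw [Finset.sum_comm, Finset.sum_congr rfl fun g _ => sum_filter_mem_apply_eq H g, ← Finset.sum_filter,
      Finset.sum_const, nsmul_eq_mul, mul_comm]
  have := hA.symm.trans hB
  exact_mod_cast this.symm

omit [Fintype G] [DecidableEq G] in
/-- The annihilator `H^⊥` is closed under multiplication. [cite: Brzezinski2018, Appendix Lemma A.12.2] -/
theorem mul_mem_annihilator {H : AddSubgroup (AddChar (Additive G) ℂ)} {x y : G}
    (hx : ∀ χ ∈ H, χ (Additive.ofMul x) = 1) (hy : ∀ χ ∈ H, χ (Additive.ofMul y) = 1) :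
    ∀ χ ∈ H, χ (Additive.ofMul (x * y)) = 1 := fun χ hχ => by
  rw [char_mul_sc, hx χ hχ, hy χ hχ, mul_one]

omit [Fintype G] [DecidableEq G] in
/-- `1 ∈ H^⊥`. [cite: Brzezinski2018, Appendix Lemma A.12.2] -/
theorem one_mem_annihilator (H : AddSubgroup (AddChar (Additive G) ℂ)) :
    ∀ χ ∈ H, χ (Additive.ofMul (1 : G)) = 1 := fun χ _ => char_one_sc χ

/-- **`Σ_{g ∈ H^⊥} χ(g) = |H^⊥|` if `χ` is trivial on `H^⊥`, `= 0` otherwise.** [cite: Brzezinski2018, Appendix Lemma A.12.2] -/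
theorem sum_annihilator_apply_eq (H : AddSubgroup (AddChar (Additive G) ℂ)) (χ : AddChar (Additive G) ℂ) :
    ∑ s ∈ Finset.univ.filter (fun g : G => ∀ ψ ∈ H, ψ (Additive.ofMul g) = 1), χ (Additive.ofMul s) =
      if ∀ s ∈ Finset.univ.filter (fun g : G => ∀ ψ ∈ H, ψ (Additive.ofMul g) = 1), χ (Additive.ofMul s) = 1 then
        ((Finset.univ.filter fun g : G => ∀ ψ ∈ H, ψ (Additive.ofMul g) = 1).card : ℂ) else 0 :=
  sum_char_eq_ite_of_mul_mem_sc (fun x hx y hy => by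
    simp only [Finset.mem_filter, Finset.mem_univ, true_and] at hx hy ⊢
    exact mul_mem_annihilator hx hy) χ

/-- **`|H^⊥|·|H^⊥⊥| = |G|`**, `H^⊥⊥ = {χ : χ(g) = 1 ∀ g ∈ H^⊥}` the characters trivial on the annihilator — the
character group of `G/H^⊥`. [cite: Brzezinski2018, Appendix Thm. A.12.1 and Lemma A.12.2] -/
theorem card_annihilator_mul_card_filter_eq (H : AddSubgroup (AddChar (Additive G) ℂ)) :
    (Finset.univ.filter fun g : G => ∀ ψ ∈ H, ψ (Additive.ofMul g) = 1).card *
      (Finset.univ.filter fun χ : AddChar (Additive G) ℂ =>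
        ∀ s ∈ Finset.univ.filter (fun g : G => ∀ ψ ∈ H, ψ (Additive.ofMul g) = 1),
          χ (Additive.ofMul s) = 1).card = Fintype.card G :=
  card_mul_card_filter_eq_sc (by
    simp only [Finset.mem_filter, Finset.mem_univ, true_and]
    exact one_mem_annihilator H) (sum_annihilator_apply_eq H)

/-- **THE DOUBLE ANNIHILATOR THEOREM `H^⊥⊥ = H`**: a character of a finite commutative group `G` that is trivial on
`H^⊥ = ⋂_{ψ ∈ H} ker ψ` lies in `H` (`H ⊆ H^⊥⊥` and `|H|·|H^⊥| = |G| = |H^⊥|·|H^⊥⊥|`).  Subgroups of `Ĝ` and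
subgroups of `G` correspond bijectively under `H ↦ H^⊥`. [cite: Brzezinski2018, Appendix Thm. A.12.1 and Lemma A.12.2] -/
theorem forall_annihilator_apply_eq_one_iff_mem (H : AddSubgroup (AddChar (Additive G) ℂ))
    (χ : AddChar (Additive G) ℂ) :
    (∀ g : G, (∀ ψ ∈ H, ψ (Additive.ofMul g) = 1) → χ (Additive.ofMul g) = 1) ↔ χ ∈ H := by
  constructor
  · intro hχ
    have hHF : (Finset.univ.filter fun φ : AddChar (Additive G) ℂ => φ ∈ H) ⊆
        Finset.univ.filter fun φ : AddChar (Additive G) ℂ =>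
          ∀ s ∈ Finset.univ.filter (fun g : G => ∀ ψ ∈ H, ψ (Additive.ofMul g) = 1),
            φ (Additive.ofMul s) = 1 := by
      intro φ hφ
      simp only [Finset.mem_filter, Finset.mem_univ, true_and] at hφ ⊢
      exact fun g hg => hg φ hφ
    have hpos : 0 < (Finset.univ.filter fun g : G => ∀ ψ ∈ H, ψ (Additive.ofMul g) = 1).card :=
      Finset.card_pos.2 ⟨1, by
        simp only [Finset.mem_filter, Finset.mem_univ, true_and]
        exact one_mem_annihilator H⟩
    have hcard : (Finset.univ.filter fun φ : AddChar (Additive G) ℂ => φ ∈ H).card =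
        (Finset.univ.filter fun φ : AddChar (Additive G) ℂ =>
          ∀ s ∈ Finset.univ.filter (fun g : G => ∀ ψ ∈ H, ψ (Additive.ofMul g) = 1),
            φ (Additive.ofMul s) = 1).card := by
      apply Nat.eq_of_mul_eq_mul_left hpos
      rw [mul_comm, card_filter_mem_mul_card_annihilator_eq H, card_annihilator_mul_card_filter_eq H]
    have hEq := Finset.eq_of_subset_of_card_le hHF hcard.ge
    have hχF : χ ∈ Finset.univ.filter fun φ : AddChar (Additive G) ℂ =>
        ∀ s ∈ Finset.univ.filter (fun g : G => ∀ ψ ∈ H, ψ (Additive.ofMul g) = 1),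
          φ (Additive.ofMul s) = 1 := by
      simp only [Finset.mem_filter, Finset.mem_univ, true_and]
      exact hχ
    rw [← hEq] at hχF
    exact (Finset.mem_filter.1 hχF).2
  · intro hχ g hg
    exact hg χ hχ

omit [DecidableEq G] in
/-- `|H| = Nat.card H` for the finset of a subgroup of characters. [cite: Brzezinski2018, Appendix Thm. A.12.1] -/
theorem natCard_eq_card_filter_mem (H : AddSubgroup (AddChar (Additive G) ℂ)) :
    Nat.card H = (Finset.univ.filter fun χ : AddChar (Additive G) ℂ => χ ∈ H).card := by
  rw [← Nat.card_eq_finsetCard]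
  exact Nat.card_congr (Equiv.subtypeEquivRight fun χ => by
    simp only [Finset.mem_filter, Finset.mem_univ, true_and])

omit [DecidableEq G] in
/-- **`Nat.card H · |H^⊥| = |G|`.** [cite: Brzezinski2018, Appendix Thm. A.12.1 and Lemma A.12.2] -/
theorem natCard_mul_card_annihilator_eq (H : AddSubgroup (AddChar (Additive G) ℂ)) :
    Nat.card H * (Finset.univ.filter fun g : G => ∀ χ ∈ H, χ (Additive.ofMul g) = 1).card = Fintype.card G := by
  rw [natCard_eq_card_filter_mem]
  exact card_filter_mem_mul_card_annihilator_eq H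

end Duality

/-! ## §2 The survivors generate the characters trivial on the stabiliser -/

section Survivors

/-- **`⟨S(T)⟩^⊥ = Stab(T)`**: every character of the group generated by the survivors is `1` at `g` iff `g`
stabilises `T` (the survivors themselves cut out `Stab(T)`, tree `forall_mul_mem_iff_iff_forall_survivor`, and the
condition `χ(g) = 1` is inherited by sums and negatives). [cite: Kubota1965, §4 Lemma 2] [cite: Dodson1984, §3.1.1 Theorem (proof)] -/
theorem forall_mem_closure_apply_eq_one_iff (h : IsCMTypeWith ρ (T : Set G)) (g : G) :
    (∀ χ ∈ AddSubgroup.closure {χ : AddChar (Additive G) ℂ |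
        χ (Additive.ofMul ρ) = -1 ∧ ∑ s ∈ T, χ (Additive.ofMul s) ≠ 0}, χ (Additive.ofMul g) = 1) ↔
      ∀ t : G, t * g ∈ T ↔ t ∈ T := by
  constructor
  · intro hg
    exact forall_mul_mem_iff_of_forall_survivor h fun χ hχ hS => hg χ (AddSubgroup.subset_closure ⟨hχ, hS⟩)
  · intro hg χ hχ
    refine AddSubgroup.closure_induction (p := fun χ _ => χ (Additive.ofMul g) = 1) ?_ ?_ ?_ ?_ hχ
    · rintro ψ ⟨hψ, hS⟩
      exact survivor_apply_eq_one_of_forall_mul_mem_iff hg hψ hS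
    · exact AddChar.zero_apply _
    · intro ψ φ _ _ hψ hφ
      rw [AddChar.add_apply, hψ, hφ, mul_one]
    · intro ψ _ hψ
      rw [AddChar.neg_apply', hψ, inv_one]

/-- The annihilator of `⟨S(T)⟩` is the stabiliser, as finsets. [cite: Kubota1965, §4 Lemma 2] [cite: Dodson1984, §3.1.1 Theorem (proof)] -/
theorem filter_forall_mem_closure_eq_stabilizer (h : IsCMTypeWith ρ (T : Set G)) :
    (Finset.univ.filter fun g : G => ∀ χ ∈ AddSubgroup.closure {χ : AddChar (Additive G) ℂ |
        χ (Additive.ofMul ρ) = -1 ∧ ∑ s ∈ T, χ (Additive.ofMul s) ≠ 0}, χ (Additive.ofMul g) = 1) =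
      Finset.univ.filter fun g : G => ∀ t : G, t * g ∈ T ↔ t ∈ T :=
  Finset.filter_congr fun g _ => forall_mem_closure_apply_eq_one_iff h g

/-- **`Stab(T)^⊥ = ⟨S(T)⟩`: A CHARACTER IS TRIVIAL ON THE STABILISER OF A CM TYPE IFF IT LIES IN THE GROUP GENERATED
BY KUBOTA'S SURVIVORS** (double annihilator: `Stab(T) = ⟨S⟩^⊥`, so `Stab(T)^⊥ = ⟨S⟩^⊥⊥ = ⟨S⟩`).  On the field side
(`G = Gal(K/ℚ)`, `K` abelian CM, `Stab(T) = Gal(K/K*)`): the character group of `Gal(K*/ℚ)` — the characters of `G`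
trivial on `Gal(K/K*)` — is generated by the odd characters `χ` with `Σ_{t ∈ T} χ(t) ≠ 0`; `K*` is the compositum of
the cyclic fields cut out by the survivors. [cite: Kubota1965, §4 Lemma 2] [cite: Dodson1984, §1.3 Reflex Degree Theorem (proof)]
[cite: Brzezinski2018, Appendix Lemma A.12.2] -/
theorem forall_stabilizer_apply_eq_one_iff_mem_closure (h : IsCMTypeWith ρ (T : Set G))
    (χ : AddChar (Additive G) ℂ) :
    (∀ s : G, (∀ t : G, t * s ∈ T ↔ t ∈ T) → χ (Additive.ofMul s) = 1) ↔
      χ ∈ AddSubgroup.closure {χ : AddChar (Additive G) ℂ |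
        χ (Additive.ofMul ρ) = -1 ∧ ∑ s ∈ T, χ (Additive.ofMul s) ≠ 0} := by
  constructor
  · intro hχ
    exact (forall_annihilator_apply_eq_one_iff_mem _ χ).1 fun g hg =>
      hχ g ((forall_mem_closure_apply_eq_one_iff h g).1 hg)
  · intro hχ s hs
    exact (forall_mem_closure_apply_eq_one_iff h s).2 hs χ hχ

/-- The characters trivial on the stabiliser (in the tree's finset form) are the finset of `⟨S(T)⟩`.
[cite: Kubota1965, §4 Lemma 2] [cite: Dodson1984, §1.3 Reflex Degree Theorem (proof)] -/
theorem filter_forall_stabilizer_eq_filter_mem_closure (h : IsCMTypeWith ρ (T : Set G)) :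
    (Finset.univ.filter fun χ : AddChar (Additive G) ℂ =>
        ∀ s ∈ Finset.univ.filter (fun g : G => ∀ t : G, t * g ∈ T ↔ t ∈ T), χ (Additive.ofMul s) = 1) =
      Finset.univ.filter fun χ : AddChar (Additive G) ℂ => χ ∈ AddSubgroup.closure {χ : AddChar (Additive G) ℂ |
        χ (Additive.ofMul ρ) = -1 ∧ ∑ s ∈ T, χ (Additive.ofMul s) ≠ 0} := by
  refine Finset.filter_congr fun χ _ => ?_
  rw [← forall_stabilizer_apply_eq_one_iff_mem_closure h χ]
  simp only [Finset.mem_filter, Finset.mem_univ, true_and]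

/-- **`|⟨S(T)⟩|·|Stab(T)| = |G|`** — on the field side **`[K* : ℚ] = |⟨S(T)⟩|`**, the reflex degree is the order of
the group generated by the survivors (`[K* : ℚ] = (G : Stab)`, Dodson). [cite: Dodson1984, §1.3 Reflex Degree Theorem (proof and Remark)]
[cite: Kubota1965, §4 Lemma 2] [cite: Brzezinski2018, Appendix Lemma A.12.2] -/
theorem card_filter_mem_closure_mul_card_stabilizer_eq (h : IsCMTypeWith ρ (T : Set G)) :
    (Finset.univ.filter fun χ : AddChar (Additive G) ℂ => χ ∈ AddSubgroup.closure {χ : AddChar (Additive G) ℂ |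
        χ (Additive.ofMul ρ) = -1 ∧ ∑ s ∈ T, χ (Additive.ofMul s) ≠ 0}).card *
      (Finset.univ.filter fun g : G => ∀ t : G, t * g ∈ T ↔ t ∈ T).card = Fintype.card G := by
  rw [← filter_forall_mem_closure_eq_stabilizer h]
  exact card_filter_mem_mul_card_annihilator_eq _

/-- `Nat.card ⟨S(T)⟩ · |Stab(T)| = |G|`. [cite: Dodson1984, §1.3 Reflex Degree Theorem (proof and Remark)]
[cite: Kubota1965, §4 Lemma 2] -/
theorem natCard_closure_mul_card_stabilizer_eq (h : IsCMTypeWith ρ (T : Set G)) :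
    Nat.card (AddSubgroup.closure {χ : AddChar (Additive G) ℂ |
        χ (Additive.ofMul ρ) = -1 ∧ ∑ s ∈ T, χ (Additive.ofMul s) ≠ 0}) *
      (Finset.univ.filter fun g : G => ∀ t : G, t * g ∈ T ↔ t ∈ T).card = Fintype.card G := by
  rw [natCard_eq_card_filter_mem]
  exact card_filter_mem_closure_mul_card_stabilizer_eq h

/-- `|⟨S(T)⟩|` divides `|G|`. [cite: Dodson1984, §1.3 Reflex Degree Theorem] -/
theorem card_filter_mem_closure_dvd (h : IsCMTypeWith ρ (T : Set G)) :
    (Finset.univ.filter fun χ : AddChar (Additive G) ℂ => χ ∈ AddSubgroup.closure {χ : AddChar (Additive G) ℂ |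
        χ (Additive.ofMul ρ) = -1 ∧ ∑ s ∈ T, χ (Additive.ofMul s) ≠ 0}).card ∣ Fintype.card G :=
  Dvd.intro _ (card_filter_mem_closure_mul_card_stabilizer_eq h)

/-- **Half of `⟨S(T)⟩` is odd**: `2·#{χ ∈ ⟨S⟩ : χ(ρ) = −1} = |⟨S⟩|` (tree `two_mul_card_filter_odd_eq` for the
characters trivial on the stabiliser). [cite: Kubota1965, §4 Lemma 2] [cite: Shimura1998, §32.10] -/
theorem two_mul_card_filter_odd_mem_closure_eq (h : IsCMTypeWith ρ (T : Set G)) :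
    2 * ((Finset.univ.filter fun χ : AddChar (Additive G) ℂ => χ ∈ AddSubgroup.closure {χ : AddChar (Additive G) ℂ |
        χ (Additive.ofMul ρ) = -1 ∧ ∑ s ∈ T, χ (Additive.ofMul s) ≠ 0}).filter
          fun χ => χ (Additive.ofMul ρ) = -1).card =
      (Finset.univ.filter fun χ : AddChar (Additive G) ℂ => χ ∈ AddSubgroup.closure {χ : AddChar (Additive G) ℂ |
        χ (Additive.ofMul ρ) = -1 ∧ ∑ s ∈ T, χ (Additive.ofMul s) ≠ 0}).card := by
  rw [← filter_forall_stabilizer_eq_filter_mem_closure h]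
  exact two_mul_card_filter_odd_eq h

/-- **`T` IS PRIMITIVE (`Stab(T) = 1`) IFF THE SURVIVORS GENERATE THE WHOLE CHARACTER GROUP** (`⟨S(T)⟩ = Ĝ`; field
side: `K* = K` iff the odd characters with `Σ_{t∈T} χ(t) ≠ 0` generate `Gal(K/ℚ)^∧`).  Contains Kubota's "a
nondegenerate CM-type is primitive" (all odd characters survive and generate `Ĝ`). [cite: Kubota1965, §2]
[cite: Dodson1984, §1.3 Reflex Degree Theorem] [cite: Shimura1998, §8.4 Example (1)] -/
theorem forall_stabilizer_eq_one_iff_closure_eq_top (h : IsCMTypeWith ρ (T : Set G)) :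
    (∀ g : G, (∀ t : G, t * g ∈ T ↔ t ∈ T) → g = 1) ↔
      AddSubgroup.closure {χ : AddChar (Additive G) ℂ |
        χ (Additive.ofMul ρ) = -1 ∧ ∑ s ∈ T, χ (Additive.ofMul s) ≠ 0} = ⊤ := by
  rw [AddSubgroup.eq_top_iff']
  constructor
  · intro hprim χ
    rw [← forall_stabilizer_apply_eq_one_iff_mem_closure h χ]
    intro s hs
    rw [hprim s hs, char_one_sc]
  · intro htop g hg
    have hall : ∀ χ : AddChar (Additive G) ℂ, χ (Additive.ofMul g) = 1 := fun χ =>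
      (forall_mem_closure_apply_eq_one_iff h g).2 hg χ (htop χ)
    have h0 : (Additive.ofMul g : Additive G) = 0 := (AddChar.forall_apply_eq_zero (α := Additive G)).1 hall
    simpa using congrArg Additive.toMul h0

end Survivors

/-! ## §3 The rank: `2·(rank(T) − 1) ≤ |⟨S(T)⟩|`, with equality iff every odd character of `⟨S(T)⟩` survives -/

section Rank

/-- **`2·(rank(T) − 1) ≤ |⟨S(T)⟩|`**: the survivors number `rank(T) − 1` (Kubota) and lie in the odd half of the group
they generate — on the field side `rank(Φ) ≤ [K* : ℚ]/2 + 1` (Shimura's reflex bound) with `[K* : ℚ] = |⟨S⟩|`.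
[cite: Kubota1965, §4 Lemma 2] [cite: Shimura1998, §32.10] [cite: Dodson1984, §1.3 Reflex Degree Theorem] -/
theorem two_mul_typeRank_sub_one_le_card_filter_mem_closure (h : IsCMTypeWith ρ (T : Set G)) :
    2 * (typeRank G (T : Set G) - 1) ≤
      (Finset.univ.filter fun χ : AddChar (Additive G) ℂ => χ ∈ AddSubgroup.closure {χ : AddChar (Additive G) ℂ |
        χ (Additive.ofMul ρ) = -1 ∧ ∑ s ∈ T, χ (Additive.ofMul s) ≠ 0}).card := by
  have h1 := two_mul_card_stabilizer_mul_typeRank_sub_one_le h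
  rw [← card_filter_mem_closure_mul_card_stabilizer_eq h] at h1
  have hpos := card_stabilizer_pos T
  have h2 : 2 * (typeRank G (T : Set G) - 1) *
      (Finset.univ.filter fun g : G => ∀ t : G, t * g ∈ T ↔ t ∈ T).card ≤
      (Finset.univ.filter fun χ : AddChar (Additive G) ℂ => χ ∈ AddSubgroup.closure {χ : AddChar (Additive G) ℂ |
        χ (Additive.ofMul ρ) = -1 ∧ ∑ s ∈ T, χ (Additive.ofMul s) ≠ 0}).card *
      (Finset.univ.filter fun g : G => ∀ t : G, t * g ∈ T ↔ t ∈ T).card := by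
    calc 2 * (typeRank G (T : Set G) - 1) * (Finset.univ.filter fun g : G => ∀ t : G, t * g ∈ T ↔ t ∈ T).card
        = 2 * (Finset.univ.filter fun g : G => ∀ t : G, t * g ∈ T ↔ t ∈ T).card *
            (typeRank G (T : Set G) - 1) := by ring
      _ ≤ _ := h1
  exact Nat.le_of_mul_le_mul_right h2 hpos

/-- **THE EQUALITY CASE ON THE DUAL SIDE: `2·|Stab(T)|·(rank(T) − 1) = |G|` iff every odd character of the group
`⟨S(T)⟩` generated by the survivors is itself a survivor** (tree `two_mul_card_stabilizer_mul_eq_iff`: iff every odd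
character trivial on `Stab(T)` survives; and `Stab(T)^⊥ = ⟨S(T)⟩`).  On the field side (abelian CM field `K`, any CM
type, any abelian variety `A` of the type; tree `Pohlmann1968.forall_hodgeClassSpan_eq_iff_forall_oddCharacter`):
`Bᵐ(A) ⊗ ℂ = Dᵐ(A) ⊗ ℂ` for all `m` iff the odd part of `⟨S⟩` consists of survivors — a criterion on Kubota's survivors
alone. [cite: Kubota1965, §2 and §4 Lemma 2] [cite: Shimura1998, §32.10] [cite: Dodson1984, §1.3 Reflex Degree Theorem] -/
theorem two_mul_card_stabilizer_mul_eq_iff_forall_mem_closure (h : IsCMTypeWith ρ (T : Set G)) :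
    2 * (Finset.univ.filter fun g : G => ∀ t : G, t * g ∈ T ↔ t ∈ T).card * (typeRank G (T : Set G) - 1) =
      Fintype.card G ↔
      ∀ χ ∈ AddSubgroup.closure {χ : AddChar (Additive G) ℂ |
          χ (Additive.ofMul ρ) = -1 ∧ ∑ s ∈ T, χ (Additive.ofMul s) ≠ 0},
        χ (Additive.ofMul ρ) = -1 → ∑ s ∈ T, χ (Additive.ofMul s) ≠ 0 := by
  rw [two_mul_card_stabilizer_mul_eq_iff h]
  constructor
  · intro H χ hχ hρ
    exact H χ hρ ((forall_stabilizer_apply_eq_one_iff_mem_closure h χ).2 hχ)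
  · intro H χ hρ htriv
    exact H χ ((forall_stabilizer_apply_eq_one_iff_mem_closure h χ).1 htriv) hρ

/-- **`2·|Stab(T)|·(rank(T) − 1) = |G| ⟺ 2·(rank(T) − 1) = |⟨S(T)⟩|`**: the equality case holds iff the survivors
generate a group of order EXACTLY `2·(rank(T) − 1)` (it is never smaller) — on the field side iff
`[K* : ℚ] = 2·(rank(Φ) − 1)`. [cite: Kubota1965, §4 Lemma 2] [cite: Shimura1998, §32.10]
[cite: Dodson1984, §1.3 Reflex Degree Theorem (Remark)] -/
theorem two_mul_card_stabilizer_mul_eq_iff_two_mul_typeRank_sub_one_eq (h : IsCMTypeWith ρ (T : Set G)) :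
    2 * (Finset.univ.filter fun g : G => ∀ t : G, t * g ∈ T ↔ t ∈ T).card * (typeRank G (T : Set G) - 1) =
      Fintype.card G ↔
      2 * (typeRank G (T : Set G) - 1) =
        (Finset.univ.filter fun χ : AddChar (Additive G) ℂ => χ ∈ AddSubgroup.closure {χ : AddChar (Additive G) ℂ |
          χ (Additive.ofMul ρ) = -1 ∧ ∑ s ∈ T, χ (Additive.ofMul s) ≠ 0}).card := by
  rw [← card_filter_mem_closure_mul_card_stabilizer_eq h]
  have hpos := card_stabilizer_pos T
  constructor
  · intro H
    apply Nat.eq_of_mul_eq_mul_right hpos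
    calc 2 * (typeRank G (T : Set G) - 1) * (Finset.univ.filter fun g : G => ∀ t : G, t * g ∈ T ↔ t ∈ T).card
        = 2 * (Finset.univ.filter fun g : G => ∀ t : G, t * g ∈ T ↔ t ∈ T).card *
            (typeRank G (T : Set G) - 1) := by ring
      _ = _ := H
  · intro H
    calc 2 * (Finset.univ.filter fun g : G => ∀ t : G, t * g ∈ T ↔ t ∈ T).card * (typeRank G (T : Set G) - 1)
        = 2 * (typeRank G (T : Set G) - 1) *
            (Finset.univ.filter fun g : G => ∀ t : G, t * g ∈ T ↔ t ∈ T).card := by ring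
      _ = _ := by rw [H]

/-- **`2·|Stab(T)|·(rank(T) − 1) < |G|` iff some odd character of `⟨S(T)⟩` is annihilated by `T`** — on the field
side: iff the abelian variety carries an exceptional Hodge class (tree `Pohlmann1968.exists_exceptional_iff_exists_oddCharacter`).
[cite: Kubota1965, §2 and §4 Lemma 2] [cite: Shimura1998, §32.10] -/
theorem two_mul_card_stabilizer_mul_lt_iff_exists_mem_closure (h : IsCMTypeWith ρ (T : Set G)) :
    2 * (Finset.univ.filter fun g : G => ∀ t : G, t * g ∈ T ↔ t ∈ T).card * (typeRank G (T : Set G) - 1) <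
      Fintype.card G ↔
      ∃ χ ∈ AddSubgroup.closure {χ : AddChar (Additive G) ℂ |
          χ (Additive.ofMul ρ) = -1 ∧ ∑ s ∈ T, χ (Additive.ofMul s) ≠ 0},
        χ (Additive.ofMul ρ) = -1 ∧ ∑ s ∈ T, χ (Additive.ofMul s) = 0 := by
  rw [(two_mul_card_stabilizer_mul_typeRank_sub_one_le h).lt_iff_ne, Ne,
    two_mul_card_stabilizer_mul_eq_iff_forall_mem_closure h]
  constructor
  · intro H
    by_contra hno
    exact H fun χ hχ hρ hS => hno ⟨χ, hχ, hρ, hS⟩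
  · rintro ⟨χ, hχ, hρ, hS⟩ H
    exact H χ hχ hρ hS

/-- **An odd number of survivors whose sum is annihilated by `T` forces the strict inequality** (the sum is an odd
character of `⟨S(T)⟩`: `(Σ_{χ ∈ D} χ)(ρ) = (−1)^{|D|} = −1`). [cite: Kubota1965, §4 Lemma 2] [cite: Shimura1998, §32.10] -/
theorem two_mul_card_stabilizer_mul_lt_of_sum_vanishing (h : IsCMTypeWith ρ (T : Set G))
    {D : Finset (AddChar (Additive G) ℂ)}
    (hD : ∀ χ ∈ D, χ (Additive.ofMul ρ) = -1 ∧ ∑ s ∈ T, χ (Additive.ofMul s) ≠ 0) (hodd : Odd D.card)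
    (h0 : ∑ s ∈ T, (∑ χ ∈ D, χ) (Additive.ofMul s) = 0) :
    2 * (Finset.univ.filter fun g : G => ∀ t : G, t * g ∈ T ↔ t ∈ T).card * (typeRank G (T : Set G) - 1) <
      Fintype.card G := by
  rw [two_mul_card_stabilizer_mul_lt_iff_exists_mem_closure h]
  refine ⟨∑ χ ∈ D, χ, sum_mem fun χ hχ => AddSubgroup.subset_closure (hD χ hχ), ?_, h0⟩
  rw [AddChar.sum_apply, Finset.prod_congr rfl fun χ hχ => (hD χ hχ).1, Finset.prod_const, hodd.neg_one_pow]

/-- **Three survivors `χ₁, χ₂, χ₃` with `Σ_{t ∈ T} (χ₁χ₂χ₃)(t) = 0` force `2·|Stab(T)|·(rank(T) − 1) < |G|`** (an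
exceptional Hodge class on the field side); for the majority types of the tree `χ₁ + χ₂ + χ₃` survives instead and
equality holds. [cite: Kubota1965, §4 Lemma 2] [cite: Shimura1998, §32.10] -/
theorem two_mul_card_stabilizer_mul_lt_of_add_add_vanishing (h : IsCMTypeWith ρ (T : Set G))
    {χ₁ χ₂ χ₃ : AddChar (Additive G) ℂ}
    (h₁ : χ₁ (Additive.ofMul ρ) = -1) (hS₁ : ∑ s ∈ T, χ₁ (Additive.ofMul s) ≠ 0)
    (h₂ : χ₂ (Additive.ofMul ρ) = -1) (hS₂ : ∑ s ∈ T, χ₂ (Additive.ofMul s) ≠ 0)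
    (h₃ : χ₃ (Additive.ofMul ρ) = -1) (hS₃ : ∑ s ∈ T, χ₃ (Additive.ofMul s) ≠ 0)
    (h0 : ∑ s ∈ T, (χ₁ + χ₂ + χ₃) (Additive.ofMul s) = 0) :
    2 * (Finset.univ.filter fun g : G => ∀ t : G, t * g ∈ T ↔ t ∈ T).card * (typeRank G (T : Set G) - 1) <
      Fintype.card G := by
  rw [two_mul_card_stabilizer_mul_lt_iff_exists_mem_closure h]
  refine ⟨χ₁ + χ₂ + χ₃, ?_, ?_, h0⟩
  · exact AddSubgroup.add_mem _ (AddSubgroup.add_mem _ (AddSubgroup.subset_closure ⟨h₁, hS₁⟩)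
      (AddSubgroup.subset_closure ⟨h₂, hS₂⟩)) (AddSubgroup.subset_closure ⟨h₃, hS₃⟩)
  · rw [AddChar.add_apply, AddChar.add_apply, h₁, h₂, h₃]
    norm_num

/-- **The number of survivors is at most half the order of the group they generate, for every CM type on every finite
commutative group**: `2·#S(T) ≤ |⟨S(T)⟩|` (`#S(T) = rank(T) − 1`). [cite: Kubota1965, §4 Lemma 2] [cite: Shimura1998, §32.10] -/
theorem two_mul_card_survivors_le_card_filter_mem_closure (h : IsCMTypeWith ρ (T : Set G)) :
    2 * ((Finset.univ.filter fun χ : AddChar (Additive G) ℂ => χ (Additive.ofMul ρ) = -1).filter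
        fun χ => ∑ s ∈ T, χ (Additive.ofMul s) ≠ 0).card ≤
      (Finset.univ.filter fun χ : AddChar (Additive G) ℂ => χ ∈ AddSubgroup.closure {χ : AddChar (Additive G) ℂ |
        χ (Additive.ofMul ρ) = -1 ∧ ∑ s ∈ T, χ (Additive.ofMul s) ≠ 0}).card := by
  have h1 := two_mul_typeRank_sub_one_le_card_filter_mem_closure h
  rwa [typeRank_eq_one_add_card_sc h, Nat.add_sub_cancel_left] at h1

end Rank

end AbelianStabilizer

end CyclicCMType

end Literature.NumberTheory.ComplexMultiplication
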